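/-
VALUE = THEOREM, NOT summit progress (cell b2b-lgcu-borel, gen 25); crux 14079 untouched.
-/
import Mathlib
import Summits.MatrixMultiplication.MatrixMultiplication.Theorems.SubgroupIdentityDesigns.Negative.RootElements

/-!
# Borel confinement: a normal subgroup of order `p` in `GL₃(𝔽_p)` forces a fixed flag

VALUE = THEOREM (pure group theory / linear algebra, all primes `p`), NOT summit progress.  The crux
item `SubgroupIdentityDesigns` is neither restated nor weakened; this file is a `--supports`
helper under `Negative/` serving case (N) of the `p`-local trichotomy of generation 25
(`NormalSylowLaw`, `TransvectionSylow`, `OppositeRootPairs`): a member whose Sylow `p`-subgroup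
is NORMAL OF ORDER `p` is confined to a Borel subgroup.

`exists_fixed_flag_of_normal` (BOREL CONFINEMENT).  Let `H ≤ GL₃(𝔽_p)` and let `P` be a Sylow
`p`-subgroup of `H` which is normal in `H` and has order exactly `p`.  Then `H` fixes a full flag:
there are `v ≠ 0` and a functional `ψ ≠ 0` with `ψ(v) = 0` such that every `h ∈ H` satisfies
`h v ∈ 𝔽_p v` and `ψ ∘ h ∈ 𝔽_p ψ` (the line `⟨v⟩` and the plane `ker ψ ⊃ ⟨v⟩` are `H`-invariant),
i.e. `H` lies in the Borel subgroup of the flag `⟨v⟩ ⊂ ker ψ`.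

Proof.  `P = ⟨u⟩`, `N := u − 1`; `u^p = 1` gives `N^p = 0` (Frobenius in characteristic `p`),
so `N` is nilpotent and `N³ = 0` (Cayley–Hamilton).  Normality gives, for `h ∈ H`, exponents with
`h u h⁻¹ = u^j`, `h⁻¹ u h = u^{j'}`, whence the intertwining relations `h N = N (S_j h)`,
`N h = (h S_{j'}) N` with the geometric sums `S_j = 1 + u + ⋯ + u^{j-1}` (which commute with `N`).
Put `M := N` if `N² = 0` and `M := N²` otherwise: in both cases `M ≠ 0`, `M² = 0`, and
`h M = M A_h`, `M h = B_h M`.  A non-zero square-zero matrix of `Mat₃` is `v ⊗ ψ` with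
`ψ(v) = 0` (`exists_vecMulVec_of_sq_zero`: `im M ≤ ker M` and rank–nullity), and the two
intertwining relations say exactly that `⟨v⟩` and `ker ψ` are `h`-invariant
(`flag_of_intertwined`).

HONEST SCOPE.  Structure law; it empties no `(p, m, ε)` cell.  Sorry-free; standard axioms.
-/

set_option linter.dupNamespace false

noncomputable section

open scoped BigOperators Classical Matrix

namespace Summit.MatrixMultiplication.MatrixMultiplication.Theorems.SubgroupIdentityDesigns.Negative
namespace BorelConfinement

open Summit.MatrixMultiplication.MatrixMultiplication.Theorems.LieRankDesigns.Negative (GLm Mat)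
open Matrix (vecMulVec)

variable {p : ℕ} [hp : Fact p.Prime]

/-! ## 1. Square-zero matrices of `Mat₃` are root elements `v ⊗ ψ`, `ψ(v) = 0` -/

/-- A non-zero `N ∈ Mat₃(𝔽_p)` with `N² = 0` is `c ⊗ φ` with `c ≠ 0`, `φ ≠ 0`, `φ(c) = 0`. -/
theorem exists_vecMulVec_of_sq_zero {N : Mat p 3} (hN : N ≠ 0) (hNN : N * N = 0) :
    ∃ c φ : Fin 3 → ZMod p, c ≠ 0 ∧ φ ≠ 0 ∧ φ ⬝ᵥ c = 0 ∧ N = vecMulVec c φ := by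
  have hrank : N.rank ≤ 1 := by
    have hcomp : N.mulVecLin ∘ₗ N.mulVecLin = 0 := by
      rw [← Matrix.mulVecLin_mul, hNN, Matrix.mulVecLin_zero]
    have hle : LinearMap.range N.mulVecLin ≤ LinearMap.ker N.mulVecLin :=
      LinearMap.range_le_ker_iff.mpr hcomp
    have h1 := Submodule.finrank_mono hle
    have h2 := LinearMap.finrank_range_add_finrank_ker N.mulVecLin
    rw [Module.finrank_fin_fun] at h2
    unfold Matrix.rank
    omega
  obtain ⟨c, φ, hcφ⟩ := exists_eq_vecMulVec_of_rank_le_one_gl N hrank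
  have hne : vecMulVec c φ ≠ 0 := hcφ ▸ hN
  rw [Ne, Matrix.vecMulVec_eq_zero, not_or] at hne
  have hφc : φ ⬝ᵥ c = 0 := by
    have h := hNN
    rw [hcφ, RootElements.vmv_mul_vmv, smul_eq_zero] at h
    exact h.resolve_right (hcφ ▸ hN)
  exact ⟨c, φ, hne.1, hne.2, hφc, hcφ⟩

/-- **Flag from intertwining.**  If `M ≠ 0`, `M² = 0` and every `h ∈ H` satisfies `h M = M A`
and `M h = B M` for some matrices `A`, `B`, then `H` fixes the flag `⟨v⟩ ⊂ ker ψ` of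
`M = v ⊗ ψ`. -/
theorem flag_of_intertwined {M : Mat p 3} (hM : M ≠ 0) (hMM : M * M = 0)
    {H : Subgroup (GLm p 3)}
    (hA : ∀ h ∈ H, ∃ A : Mat p 3, (h : Mat p 3) * M = M * A)
    (hB : ∀ h ∈ H, ∃ B : Mat p 3, M * (h : Mat p 3) = B * M) :
    ∃ v ψ : Fin 3 → ZMod p, v ≠ 0 ∧ ψ ≠ 0 ∧ ψ ⬝ᵥ v = 0 ∧
      ∀ h ∈ H, (∃ a : ZMod p, (h : Mat p 3) *ᵥ v = a • v) ∧
        (∃ b : ZMod p, ψ ᵥ* (h : Mat p 3) = b • ψ) := by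
  obtain ⟨v, ψ, hv, hψ, hψv, hMe⟩ := exists_vecMulVec_of_sq_zero hM hMM
  obtain ⟨i₀, hi₀⟩ := Function.ne_iff.mp hv
  obtain ⟨j₀, hj₀⟩ := Function.ne_iff.mp hψ
  have hi₀' : v i₀ ≠ 0 := by simpa using hi₀
  have hj₀' : ψ j₀ ≠ 0 := by simpa using hj₀
  refine ⟨v, ψ, hv, hψ, hψv, fun h hh => ⟨?_, ?_⟩⟩
  · obtain ⟨A, hA'⟩ := hA h hh
    rw [hMe, Matrix.mul_vecMulVec, Matrix.vecMulVec_mul] at hA'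
    refine ⟨(ψ j₀)⁻¹ * (ψ ᵥ* A) j₀, ?_⟩
    funext i
    have hij := congrFun (congrFun hA' i) j₀
    simp only [Matrix.vecMulVec_apply] at hij
    simp only [Pi.smul_apply, smul_eq_mul]
    calc ((h : Mat p 3) *ᵥ v) i = (ψ j₀)⁻¹ * (((h : Mat p 3) *ᵥ v) i * ψ j₀) := by
          rw [mul_comm (((h : Mat p 3) *ᵥ v) i) (ψ j₀), ← mul_assoc, inv_mul_cancel₀ hj₀', one_mul]
      _ = (ψ j₀)⁻¹ * (ψ ᵥ* A) j₀ * v i := by rw [hij]; ring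
  · obtain ⟨B, hB'⟩ := hB h hh
    rw [hMe, Matrix.vecMulVec_mul, Matrix.mul_vecMulVec] at hB'
    refine ⟨(v i₀)⁻¹ * (B *ᵥ v) i₀, ?_⟩
    funext j
    have hij := congrFun (congrFun hB' i₀) j
    simp only [Matrix.vecMulVec_apply] at hij
    simp only [Pi.smul_apply, smul_eq_mul]
    calc (ψ ᵥ* (h : Mat p 3)) j = (v i₀)⁻¹ * (v i₀ * (ψ ᵥ* (h : Mat p 3)) j) := by
          rw [← mul_assoc, inv_mul_cancel₀ hi₀', one_mul]
      _ = (v i₀)⁻¹ * (B *ᵥ v) i₀ * ψ j := by rw [hij]; ring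

/-! ## 2. Unipotent elements: `N^p = 0`, `N³ = 0`, and the intertwining relations -/

/-- `u^p = 1` in `GL₃(𝔽_p)` gives `(u − 1)^p = 0` (Frobenius). -/
theorem sub_one_pow_prime {u : GLm p 3} (hu : u ^ p = 1) : ((u : Mat p 3) - 1) ^ p = 0 := by
  have h1 : (u : Mat p 3) = 1 + ((u : Mat p 3) - 1) := by rw [add_sub_cancel]
  have h := congrArg (fun g : GLm p 3 => (g : Mat p 3)) hu
  simp only [Units.val_pow_eq_pow_val, Units.val_one] at h
  rw [h1, add_pow_char_of_commute p (Commute.one_left _), one_pow] at h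
  exact add_eq_left.mp h

/-- A nilpotent matrix of `Mat₃` has cube zero (Cayley–Hamilton). -/
theorem cube_eq_zero {N : Mat p 3} (hnil : IsNilpotent N) : N ^ 3 = 0 := by
  have h := (Matrix.isNilpotent_charpoly_sub_pow_of_isNilpotent hnil).eq_zero
  rw [sub_eq_zero, Fintype.card_fin] at h
  have h2 := Matrix.aeval_self_charpoly N
  rwa [h, map_pow, Polynomial.aeval_X] at h2

/-- The geometric sum `S_j(U) = 1 + U + ⋯ + U^{j-1}` commutes with `U − 1`. -/
theorem commute_geom (U : Mat p 3) (j : ℕ) :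
    Commute (U - 1) (∑ i ∈ Finset.range j, U ^ i) :=
  Commute.sum_right _ _ _ fun i _ => ((Commute.refl U).pow_right i).sub_left (Commute.one_left _)

/-- Left intertwining: `X U = U^j X` gives `X (U − 1) = (U − 1) (S_j X)`. -/
theorem intertwine_left {U X : Mat p 3} {j : ℕ} (h : X * U = U ^ j * X) :
    X * (U - 1) = (U - 1) * ((∑ i ∈ Finset.range j, U ^ i) * X) := by
  rw [← mul_assoc, mul_geom_sum, sub_mul, mul_sub, one_mul, mul_one, h]

/-- Right intertwining: `U X = X U^j` gives `(U − 1) X = (X S_j) (U − 1)`. -/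
theorem intertwine_right {U X : Mat p 3} {j : ℕ} (h : U * X = X * U ^ j) :
    (U - 1) * X = (X * ∑ i ∈ Finset.range j, U ^ i) * (U - 1) := by
  rw [mul_assoc, geom_sum_mul, mul_sub, sub_mul, mul_one, one_mul, h]

/-- Left intertwining for the square: `X N = N (S X)`, `S N = N S` give `X N² = N² (S S X)`. -/
theorem intertwine_left_sq {N S X : Mat p 3} (h : X * N = N * (S * X)) (hc : Commute N S) :
    X * (N * N) = N * N * (S * (S * X)) := by
  calc X * (N * N) = N * (S * X) * N := by rw [← mul_assoc, h]
    _ = N * (S * (X * N)) := by simp only [mul_assoc]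
    _ = N * (S * (N * (S * X))) := by rw [h]
    _ = N * (S * N * (S * X)) := by simp only [mul_assoc]
    _ = N * (N * S * (S * X)) := by rw [hc.eq]
    _ = N * N * (S * (S * X)) := by simp only [mul_assoc]

/-- Right intertwining for the square: `N X = (X S) N`, `S N = N S` give `N² X = (X S S) N²`. -/
theorem intertwine_right_sq {N S X : Mat p 3} (h : N * X = X * S * N) (hc : Commute N S) :
    N * N * X = X * S * S * (N * N) := by
  calc N * N * X = N * (X * S * N) := by rw [mul_assoc, h]
    _ = N * X * (S * N) := by simp only [mul_assoc]
    _ = X * S * N * (S * N) := by rw [h]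
    _ = X * S * (N * S) * N := by simp only [mul_assoc]
    _ = X * S * (S * N) * N := by rw [hc.eq]
    _ = X * S * S * (N * N) := by simp only [mul_assoc]

/-! ## 3. Borel confinement -/

/-- Conjugation exponents: if `P ⊴ H` is a Sylow `p`-subgroup of order `p` and `1 ≠ x ∈ P`, every
`h ∈ H` conjugates `u = x` to a power of `u`. -/
theorem exists_conj_eq_pow {H : Subgroup (GLm p 3)} (P : Sylow p H) (hPn : (P : Subgroup H).Normal)
    (hcard : Nat.card P = p) {x : (P : Subgroup H)} (hx1 : x ≠ 1) {h : GLm p 3} (hh : h ∈ H) :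
    ∃ j : ℕ, h * ((x : H) : GLm p 3) * h⁻¹ = ((x : H) : GLm p 3) ^ j := by
  have hmem : (⟨h, hh⟩ * (x : H) * ⟨h, hh⟩⁻¹ : H) ∈ (P : Subgroup H) :=
    hPn.conj_mem _ x.2 ⟨h, hh⟩
  have htop : (⟨_, hmem⟩ : (P : Subgroup H)) ∈ Subgroup.zpowers x := by
    rw [zpowers_eq_top_of_prime_card hcard hx1]
    exact Subgroup.mem_top _
  rw [← (isOfFinOrder_of_finite x).mem_powers_iff_mem_zpowers, Submonoid.mem_powers_iff] at htop
  obtain ⟨j, hj⟩ := htop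
  refine ⟨j, ?_⟩
  have h' := congrArg (fun y : (P : Subgroup H) => ((y : H) : GLm p 3)) hj
  simp only [SubgroupClass.coe_pow, Subgroup.coe_mul, Subgroup.coe_inv] at h'
  exact h'.symm

/-- **BOREL CONFINEMENT.**  A subgroup `H ≤ GL₃(𝔽_p)` whose Sylow `p`-subgroup is normal of order
exactly `p` fixes a full flag `⟨v⟩ ⊂ ker ψ`: every `h ∈ H` has `h v ∈ 𝔽_p v` and
`ψ ∘ h ∈ 𝔽_p ψ`. -/
theorem exists_fixed_flag_of_normal (H : Subgroup (GLm p 3)) (P : Sylow p H)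
    (hPn : (P : Subgroup H).Normal) (hcard : Nat.card P = p) :
    ∃ v ψ : Fin 3 → ZMod p, v ≠ 0 ∧ ψ ≠ 0 ∧ ψ ⬝ᵥ v = 0 ∧
      ∀ h ∈ H, (∃ a : ZMod p, (h : Mat p 3) *ᵥ v = a • v) ∧
        (∃ b : ZMod p, ψ ᵥ* (h : Mat p 3) = b • ψ) := by
  haveI : Nontrivial (P : Subgroup H) :=
    Finite.one_lt_card_iff_nontrivial.mp (by rw [hcard]; exact hp.out.one_lt)
  obtain ⟨x, hx1⟩ := exists_ne (1 : (P : Subgroup H))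
  obtain ⟨u, hu⟩ : ∃ u : GLm p 3, ((x : H) : GLm p 3) = u := ⟨_, rfl⟩
  -- `u ^ p = 1`, `N := u - 1`, `N ^ p = 0`, `N ^ 3 = 0`.
  have hup : u ^ p = 1 := by
    have h : x ^ Nat.card (P : Subgroup H) = 1 := pow_card_eq_one'
    rw [hcard] at h
    have h' := congrArg (fun y : (P : Subgroup H) => ((y : H) : GLm p 3)) h
    simpa only [SubgroupClass.coe_pow, OneMemClass.coe_one, hu] using h'
  obtain ⟨N, hN⟩ : ∃ N : Mat p 3, (u : Mat p 3) - 1 = N := ⟨_, rfl⟩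
  have hNp : N ^ p = 0 := by rw [← hN]; exact sub_one_pow_prime hup
  have hN3 : N ^ 3 = 0 := cube_eq_zero ⟨p, hNp⟩
  have hN0 : N ≠ 0 := by
    intro h0
    apply hx1
    have h1 : u = 1 :=
      Units.ext (by rw [Units.val_one]; exact sub_eq_zero.mp (hN.trans h0))
    exact Subtype.ext (Subtype.ext (by simpa [h1] using hu))
  -- intertwining relations for every `h ∈ H`
  have hL : ∀ h ∈ H, ∃ S : Mat p 3, Commute N S ∧ (h : Mat p 3) * N = N * (S * (h : Mat p 3)) := by
    intro h hh
    obtain ⟨j, hj⟩ := exists_conj_eq_pow P hPn hcard hx1 hh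
    rw [hu] at hj
    refine ⟨∑ i ∈ Finset.range j, (u : Mat p 3) ^ i, by rw [← hN]; exact commute_geom _ j, ?_⟩
    rw [← hN]
    apply intertwine_left
    have h' := congrArg (fun g : GLm p 3 => (g : Mat p 3)) (mul_inv_eq_iff_eq_mul.mp hj)
    simpa only [Units.val_mul, Units.val_pow_eq_pow_val] using h'
  have hR : ∀ h ∈ H, ∃ S : Mat p 3, Commute N S ∧ N * (h : Mat p 3) = (h : Mat p 3) * S * N := by
    intro h hh
    obtain ⟨j, hj⟩ := exists_conj_eq_pow P hPn hcard hx1 (H.inv_mem hh)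
    rw [hu, inv_inv] at hj
    refine ⟨∑ i ∈ Finset.range j, (u : Mat p 3) ^ i, by rw [← hN]; exact commute_geom _ j, ?_⟩
    rw [← hN]
    apply intertwine_right
    have hj' : u * h = h * u ^ j := by
      rw [← hj, ← mul_assoc, ← mul_assoc, mul_inv_cancel, one_mul]
    have h' := congrArg (fun g : GLm p 3 => (g : Mat p 3)) hj'
    simpa only [Units.val_mul, Units.val_pow_eq_pow_val] using h'
  by_cases hsq : N * N = 0
  · refine flag_of_intertwined hN0 hsq (fun h hh => ?_) (fun h hh => ?_)
    · obtain ⟨S, -, hS⟩ := hL h hh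
      exact ⟨S * (h : Mat p 3), hS⟩
    · obtain ⟨S, -, hS⟩ := hR h hh
      exact ⟨(h : Mat p 3) * S, hS⟩
  · have hMM : N * N * (N * N) = 0 := by
      rw [show N * N * (N * N) = N ^ 3 * N by
        simp only [pow_succ, pow_zero, one_mul, mul_assoc], hN3, zero_mul]
    refine flag_of_intertwined hsq hMM (fun h hh => ?_) (fun h hh => ?_)
    · obtain ⟨S, hc, hS⟩ := hL h hh
      exact ⟨S * (S * (h : Mat p 3)), intertwine_left_sq hS hc⟩
    · obtain ⟨S, hc, hS⟩ := hR h hh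
      exact ⟨(h : Mat p 3) * S * S, intertwine_right_sq hS hc⟩

end BorelConfinement
end Summit.MatrixMultiplication.MatrixMultiplication.Theorems.SubgroupIdentityDesigns.Negative
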